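import Literature.NumberTheory.Transcendental.CurvePeriodsEllipticDoublingProofs
import Literature.NumberTheory.Transcendental.CurvePeriodsEllipticPolygonProofs
import HarnessLib

/-!
# Periods of curve type on an elliptic curve, VII: translation by an algebraic point as functoriality

Companion of `Literature/NumberTheory/Transcendental/CurvePeriods.lean` (Huber–Wüstholz 2022,
Thm. 13.3 (2), rendered on explicit period symbols `(Z, ω, γ)` with the elementary relations
(R1)–(R5)) and of the genus-one files `CurvePeriodsElliptic*Proofs.lean` (the affine Weierstrass
curve `E_L : y² = x³ − (g₂/4)x − g₃/4` of a period pair `L`, uniformised by `φ = (℘, ℘′/2)`, the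
forms `θ₀ = dx/y`, `θ₁ = x dx/y`). After the doubling map (`CurvePeriodsEllipticDoublingProofs.lean`,
functoriality along `[2]`), this file provides the second piece of the group law as an instance of
functoriality (R4): **translation by an algebraic point** `P = φ(v)`. In the embedded rendering the
translation `τ_P : Q ↦ P + Q` is a polynomial map on the smooth affine curve

  `Z_v = {(x, y, w) ∈ 𝔸³ | y² = x³ + Ax + B, w (x − x_P) = 1}`  (`Ell.curveT`; `= E ∖ {O, P, −P}`),

namely `tra = (λ² − x − x_P, λ(x − x(P+Q)) − y)` with the chord slope `λ = (y − y_P) w`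
(Silverman AEC III.2.3), next to the inclusion `ι = (x, y)`; both are defined over `ℚ̄` when
`g₂, g₃, x_P, y_P ∈ ℚ̄`.

* `Ell.smoothT` — `Z_v` is a smooth affine curve over `ℚ̄` (gradients `(−f′, 2y, 0)`, `(w, 0, x − x_P)`;
  `(f′, y) ≠ 0` on a smooth Weierstrass curve by the Bézout identity `Weier.bezout`; no isolated
  points via the parametrisation below);
* `Ell.psiT`, `Ell.exists_psiT_eq` — `Z_v` is parametrised by `ψ_v(z) = (℘(z), ℘′(z)/2, (℘(z) − ℘(v))⁻¹)`,
  `z ∉ Λ ∪ (±v + Λ)`; `Ell.tra_psiT` — **`tra(ψ_v(z)) = φ(z + v)`** (the addition theorems for `℘`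
  and `℘′` of the tree: `PeriodPair.weierstrassP_add_holds`, `PeriodPair.derivWeierstrassP_add_of_ne`);
  `Ell.IsAlgPt.add_of_ne` — hence `z + v` is an algebraic point when `z`, `v` are;
* `Ell.vanishesOn_nuT0`, `Ell.vanishesOn_nuT1` — the identities of forms on `Z_v`

    `tra^* θ₀ = ι^* θ₀ + ν₀`,  `tra^* θ₁ = ι^* θ₁ + dR + ν₁`,  `ν₀, ν₁ = 0` on `Z_v`,  `R = −2λ`,

  i.e. `τ_P^* dz = dz` (invariant differential) and `τ_P^*(℘ dz) = ℘ dz − dλ`, the latter being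
  the addition theorem for `ζ`: `ζ(z + v) = ζ(z) + ζ(v) + λ(ψ_v(z))`
  (`PeriodPair.weierstrassZeta_add_holds`; `Ell.eval_lam_psiT_eq_zeta`), proved ANALYTICALLY along
  `ψ_v` (the tangent line at `ψ_v(z)` is spanned by `ψ_v′(z)`, `Ell.exists_eq_smul_psiTD`);
* `Ell.span_translate_theta0` — **translation invariance**: for a `C¹` map `g` on `[0,1]` avoiding
  `Λ` and `±v + Λ` with algebraic end points, `(E_L, θ₀, φ∘(g + v)) − (E_L, θ₀, φ∘g)` lies in the
  `ℚ̄`-span of the elementary relations ((R4) along `tra` and `ι` for the lifted path `ψ_v ∘ g`,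
  (R1), (R2));
* `Ell.span_translate_theta1` — the same for `θ₁` up to the algebraic constant
  `(R(ψ_v(g 1)) − R(ψ_v(g 0))) · 𝟙`, `R(ψ_v(z)) = −2(ζ(z + v) − ζ(z) − ζ(v))` ((R3) for `dR`).

These are the relations behind the addition formulas for elliptic integrals of the first and
second kind between algebraic points (book §18.1), needed for OPEN paths on `E_L` in
Theorem 13.3 (2) (the closed-path case is `CurvePeriodsEllipticEndgameHolds.lean`).

## References

* A. Huber, G. Wüstholz, *Transcendence and Linear Relations of 1-Periods*, Cambridge Tracts in
  Mathematics 227, CUP 2022 [HuberWustholz2022]: Thm. 13.3 (2) (p. 121), §13.1 (B) (p. 120,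
  functoriality), §18.1 (p. 160).
* J. H. Silverman, *The Arithmetic of Elliptic Curves*, GTM 106: III.2.3 (group law algorithm),
  III.5.1 (invariant differential). [SilvermanAEC2009]
* J. V. Armitage, W. F. Eberlein, *Elliptic Functions*, CUP 2006, §7.4.2 (addition theorems for
  `℘`, `ζ`). [ArmitageEberlein2001]
-/

noncomputable section

open scoped BigOperators
open scoped PeriodPair
open scoped Topology
open MvPolynomial Set Complex Filter

namespace Literature.NumberTheory.Transcendental

namespace CurvePeriods

set_option quotPrecheck false in
/-- Membership in the `ℚ̄`-span of the elementary relations, in the format of the conclusion of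
`HuberWustholzCurvePeriods`. -/
local notation "InSpan" c:max => ∃ (k : ℕ) (ρ : Fin k → (PeriodSymbol →₀ ℂ)) (a : Fin k → ℂ),
  (∀ l, IsElementaryRelation (ρ l)) ∧ (∀ l, IsAlgebraic ℚ (a l)) ∧ c = ∑ l, a l • ρ l

namespace Ell

variable (L : PeriodPair) (v : ℂ)

/-! ### The localised curve `Z_v = {y² = f(x), w (x − ℘(v)) = 1} ⊂ 𝔸³` (`E_L` minus `O, ±P`) -/

/-- **The affine curve `Z_v = {(x, y, w) | y² = x³ + Ax + B, w (x − x_P) = 1}`**, `x_P = ℘(v)`,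
isomorphic (by `(x, y, w) ↦ (x, y)`) to `E_L` minus the two points `±P = φ(±v)` with `x = x_P`;
the domain of the translation-by-`P` map as a polynomial map. [folklore] -/
abbrev curveT : CurveData := ⟨3, 2, ![X 1 ^ 2 - fPoly3 L, X 2 * (X 0 - C (℘[L] v)) - 1]⟩

/-- `q ∈ Z_v ↔ q₁² = f(q₀) ∧ q₂ (q₀ − ℘(v)) = 1`. [folklore] -/
theorem mem_points_curveT_iff (q : Fin 3 → ℂ) :
    q ∈ (curveT L v).points ↔
      q 1 ^ 2 = q 0 ^ 3 + A L * q 0 + B L ∧ q 2 * (q 0 - ℘[L] v) = 1 := by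
  rw [CurveData.mem_points]
  rw [show (∀ j : Fin (curveT L v).m, eval q ((curveT L v).F j) = 0) ↔
      eval q ((curveT L v).F 0) = 0 ∧ eval q ((curveT L v).F 1) = 0 from Fin.forall_fin_two]
  simp [eval_fPoly3, sub_eq_zero]

/-- The gradient of `y² − f`: `(−(3x² + A), 2y, 0)`. [folklore] -/
theorem gradient_curveT_zero (q : Fin 3 → ℂ) :
    (curveT L v).gradient 0 q = ![-(3 * q 0 ^ 2 + A L), 2 * q 1, 0] := by
  funext k
  simp only [CurveData.gradient, Matrix.cons_val_zero, map_sub, Derivation.leibniz_pow,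
    pderiv_fPoly3]
  fin_cases k <;> simp

/-- The gradient of `w (x − x_P) − 1`: `(w, 0, x − x_P)`. [folklore] -/
theorem gradient_curveT_one (q : Fin 3 → ℂ) :
    (curveT L v).gradient 1 q = ![q 2, 0, q 0 - ℘[L] v] := by
  funext k
  simp only [CurveData.gradient, Matrix.cons_val_one]
  fin_cases k <;> simp [Derivation.leibniz, pderiv_X]

/-- The tangent line of `Z_v` at `q`: `−(3q₀² + A) t₀ + 2q₁ t₁ = 0` and
`q₂ t₀ + (q₀ − x_P) t₂ = 0`. [folklore] -/
theorem mem_tangentSpace_curveT_iff (q t : Fin 3 → ℂ) :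
    t ∈ (curveT L v).tangentSpace q ↔
      -(3 * q 0 ^ 2 + A L) * t 0 + 2 * q 1 * t 1 = 0 ∧ q 2 * t 0 + (q 0 - ℘[L] v) * t 2 = 0 := by
  simp only [CurveData.tangentSpace, mem_setOf_eq]
  rw [show (∀ j : Fin (curveT L v).m, ∑ i, (curveT L v).gradient j q i * t i = 0) ↔
      (∑ i, (curveT L v).gradient 0 q i * t i = 0) ∧ (∑ i, (curveT L v).gradient 1 q i * t i = 0)
      from Fin.forall_fin_two, gradient_curveT_zero, gradient_curveT_one]
  simp [Fin.sum_univ_three]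

/-! ### The parametrisation `ψ_v(z) = (℘(z), ℘′(z)/2, (℘(z) − ℘(v))⁻¹)` of `Z_v` -/

/-- `ψ_v(z) = (℘(z), ℘′(z)/2, (℘(z) − ℘(v))⁻¹)`. [folklore] -/
def psiT (z : ℂ) : Fin 3 → ℂ := ![℘[L] z, ℘'[L] z / 2, (℘[L] z - ℘[L] v)⁻¹]

/-- `ψ_v′(z) = (℘′, 3℘² − g₂/4, −℘′/(℘ − ℘(v))²)`. [folklore] -/
def psiTD (z : ℂ) : Fin 3 → ℂ :=
  ![℘'[L] z, 3 * ℘[L] z ^ 2 - L.g₂ / 4, -℘'[L] z / (℘[L] z - ℘[L] v) ^ 2]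

/-- [folklore] -/
@[simp] theorem psiT_apply_zero (z : ℂ) : psiT L v z 0 = ℘[L] z := rfl

/-- [folklore] -/
@[simp] theorem psiT_apply_one (z : ℂ) : psiT L v z 1 = ℘'[L] z / 2 := rfl

/-- [folklore] -/
@[simp] theorem psiT_apply_two (z : ℂ) : psiT L v z 2 = (℘[L] z - ℘[L] v)⁻¹ := rfl

/-- [folklore] -/
@[simp] theorem psiTD_apply_zero (z : ℂ) : psiTD L v z 0 = ℘'[L] z := rfl

/-- [folklore] -/
@[simp] theorem psiTD_apply_one (z : ℂ) : psiTD L v z 1 = 3 * ℘[L] z ^ 2 - L.g₂ / 4 := rfl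

/-- [folklore] -/
@[simp] theorem psiTD_apply_two (z : ℂ) :
    psiTD L v z 2 = -℘'[L] z / (℘[L] z - ℘[L] v) ^ 2 := rfl

/-- `ι(ψ_v(z)) = φ(z)` (first two coordinates). [folklore] -/
theorem psiT_phi (z : ℂ) : ![psiT L v z 0, psiT L v z 1] = phi L z := rfl

/-- `ψ_v(z) ∈ Z_v` for `z ∉ Λ` with `℘(z) ≠ ℘(v)`. [folklore] -/
theorem psiT_mem_points {z : ℂ} (hz : z ∉ L.lattice) (hne : ℘[L] z ≠ ℘[L] v) :
    psiT L v z ∈ (curveT L v).points := by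
  rw [mem_points_curveT_iff]
  refine ⟨?_, ?_⟩
  · have h := (Weier.mem_points_iff (A L) (B L) (phi L z)).1 (phi_mem_points L hz)
    rw [Weier.eval_fPoly] at h
    simpa using h
  · simp only [psiT_apply_two, psiT_apply_zero]
    exact inv_mul_cancel₀ (sub_ne_zero.2 hne)

/-- `ψ_v` has complex derivative `ψ_v′` off `Λ ∪ {℘ = ℘(v)}`. [folklore] -/
theorem hasDerivAt_psiT {z : ℂ} (hz : z ∉ L.lattice) (hne : ℘[L] z ≠ ℘[L] v) :
    ∀ k : Fin 3, HasDerivAt (fun w => psiT L v w k) (psiTD L v z k) z := by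
  have h0 := hasDerivAt_phi L hz 0
  have h1 := hasDerivAt_phi L hz 1
  simp only [phi_apply_zero, phiD_apply_zero, phi_apply_one, phiD_apply_one] at h0 h1
  intro k
  fin_cases k
  · exact h0
  · exact h1
  · show HasDerivAt (fun w => (℘[L] w - ℘[L] v)⁻¹) (-℘'[L] z / (℘[L] z - ℘[L] v) ^ 2) z
    exact (h0.sub_const (℘[L] v)).inv (sub_ne_zero.2 hne)

/-- Along a real shift: `s ↦ ψ_v(z₀ + s)` has derivative `ψ_v′(z₀ + t)` at `t`. [folklore] -/
theorem hasDerivAt_psiT_shift (z₀ : ℂ) {t : ℝ} (h : z₀ + t ∉ L.lattice)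
    (hne : ℘[L] (z₀ + t) ≠ ℘[L] v) (k : Fin 3) :
    HasDerivAt (fun s : ℝ => psiT L v (z₀ + s) k) (psiTD L v (z₀ + t) k) t :=
  (HasDerivAt.comp_const_add z₀ (t : ℂ) (hasDerivAt_psiT L v h hne k)).comp_ofReal

/-- `ψ_v′(z)` is tangent to `Z_v` at `ψ_v(z)`. [folklore] -/
theorem psiTD_mem_tangentSpace {z : ℂ} (hne : ℘[L] z ≠ ℘[L] v) :
    psiTD L v z ∈ (curveT L v).tangentSpace (psiT L v z) := by
  have hD : ℘[L] z - ℘[L] v ≠ 0 := sub_ne_zero.2 hne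
  rw [mem_tangentSpace_curveT_iff]
  simp only [psiT_apply_zero, psiT_apply_one, psiT_apply_two, psiTD_apply_zero, psiTD_apply_one,
    psiTD_apply_two, A]
  constructor
  · ring
  · field_simp
    ring

/-- **`ψ_v` parametrises `Z_v`**: every point of `Z_v` is `ψ_v(z)` with `z ∉ Λ`, `℘(z) ≠ ℘(v)`.
[folklore] -/
theorem exists_psiT_eq {q : Fin 3 → ℂ} (hq : q ∈ (curveT L v).points) :
    ∃ z, z ∉ L.lattice ∧ ℘[L] z ≠ ℘[L] v ∧ psiT L v z = q := by
  rw [mem_points_curveT_iff] at hq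
  obtain ⟨hcub, hw⟩ := hq
  have hx : q 0 - ℘[L] v ≠ 0 := fun h => by simp [h] at hw
  obtain ⟨z, hz, hxz⟩ := L.exists_weierstrassP_eq (q 0)
  have hne : ℘[L] z ≠ ℘[L] v := fun h => hx (by rw [← hxz, h, sub_self])
  have hsq : (℘'[L] z / 2) ^ 2 = q 1 ^ 2 := by
    rw [hcub, ← hxz]
    have h := L.derivWeierstrassP_sq z hz
    simp only [A, B]
    linear_combination (1 / 4 : ℂ) * h
  have hw' : q 2 = (q 0 - ℘[L] v)⁻¹ := eq_inv_of_mul_eq_one_left hw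
  rcases sq_eq_sq_iff_eq_or_eq_neg.1 hsq with h | h
  · refine ⟨z, hz, hne, ?_⟩
    funext k
    fin_cases k
    · simpa using hxz
    · simpa using h
    · simp [hw', hxz]
  · have hz' : -z ∉ L.lattice := fun h' => hz (by simpa using neg_mem h')
    refine ⟨-z, hz', by rwa [L.weierstrassP_neg], ?_⟩
    funext k
    fin_cases k
    · simpa [L.weierstrassP_neg] using hxz
    · simp [L.derivWeierstrassP_neg, neg_div, h]
    · simp [L.weierstrassP_neg, hw', hxz]

/-- For `z₀ ∉ Λ` with `℘(z₀) ≠ ℘(v)`, `℘(z₀ + t) ≠ ℘(v)` for small real `t`. [folklore] -/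
theorem eventually_shift_ne {z₀ : ℂ} (hz₀ : z₀ ∉ L.lattice) (hne : ℘[L] z₀ ≠ ℘[L] v) :
    ∀ᶠ t : ℝ in 𝓝 0, ℘[L] (z₀ + (t : ℂ)) ≠ ℘[L] v := by
  have hshift : Continuous fun t : ℝ => z₀ + (t : ℂ) := by fun_prop
  have hc : ContinuousAt (fun t : ℝ => ℘[L] (z₀ + (t : ℂ))) 0 := by
    have hd : ContinuousAt ℘[L] z₀ :=
      (L.differentiableOn_weierstrassP.differentiableAt
        (L.isClosed_lattice.isOpen_compl.mem_nhds hz₀)).continuousAt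
    exact hd.comp_of_eq hshift.continuousAt (by simp)
  exact hc.eventually_ne (by simpa using hne)

/-! ### `Z_v` is a smooth affine curve over `ℚ̄` -/

/-- On `E_{A,B}` the gradient `(−f′(x), 2y)` never vanishes (`Δ ≠ 0`: Bézout). [folklore] -/
theorem fderiv_ne_zero_of_y_eq_zero {q : Fin 3 → ℂ} (hcub : q 1 ^ 2 = q 0 ^ 3 + A L * q 0 + B L)
    (hy : q 1 = 0) : 3 * q 0 ^ 2 + A L ≠ 0 := by
  intro hf
  have hb := Weier.eval_bezout (A L) (B L) ![q 0, q 1]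
  rw [Weier.eval_pderiv_zero_fPoly, Weier.eval_fPoly] at hb
  simp only [Matrix.cons_val_zero] at hb
  have hf0 : q 0 ^ 3 + A L * q 0 + B L = 0 := by rw [← hcub, hy]; ring
  rw [hf, hf0, mul_zero, mul_zero, sub_zero] at hb
  exact disc_ne_zero L hb.symm

/-- **`Z_v` is a smooth affine curve over `ℚ̄`** (for `g₂, g₃ ∈ ℚ̄` and `℘(v) ∈ ℚ̄`): the two
gradients `(−f′, 2y, 0)`, `(w, 0, x − x_P)` are independent at every point (`x ≠ x_P` on `Z_v`,
and `(f′, y) ≠ 0` on a smooth Weierstrass curve), and no point is isolated. [folklore] -/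
theorem smoothT (h₂ : IsAlgebraic ℚ L.g₂) (h₃ : IsAlgebraic ℚ L.g₃) (hv : IsAlgebraic ℚ (℘[L] v)) :
    (curveT L v).IsSmoothAffineCurve where
  algebraic j := by
    fin_cases j
    · simpa using ((hasAlgCoeffs_X (n := 3) 1).pow 2).sub (hasAlgCoeffs_fPoly3 L h₂ h₃)
    · simpa using ((hasAlgCoeffs_X (n := 3) 2).mul ((hasAlgCoeffs_X 0).sub
        (hasAlgCoeffs_C hv))).sub hasAlgCoeffs_one
  rank_eq q hq := by
    rw [mem_points_curveT_iff] at hq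
    obtain ⟨hcub, hw⟩ := hq
    have hx : q 0 - ℘[L] v ≠ 0 := fun h => by simp [h] at hw
    have hfun : (fun j => (curveT L v).gradient j q) =
        ![![-(3 * q 0 ^ 2 + A L), 2 * q 1, 0], ![q 2, 0, q 0 - ℘[L] v]] := by
      funext j
      fin_cases j
      · simpa using gradient_curveT_zero L v q
      · simpa using gradient_curveT_one L v q
    have hli : LinearIndependent ℂ
        ![![-(3 * q 0 ^ 2 + A L), 2 * q 1, 0], ![q 2, 0, q 0 - ℘[L] v]] := by
      rw [LinearIndependent.pair_iff]
      intro s t hst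
      have h2 := congrFun hst 2
      have h1 := congrFun hst 1
      have h0 := congrFun hst 0
      simp only [Pi.add_apply, Pi.smul_apply, Matrix.cons_val_zero, Matrix.cons_val_one,
        Matrix.head_cons, smul_eq_mul, mul_zero, zero_add, add_zero, Pi.zero_apply,
        Matrix.cons_val_two, Matrix.tail_cons] at h0 h1 h2
      have ht : t = 0 := (mul_eq_zero.mp h2).resolve_right hx
      rw [ht, zero_mul, add_zero] at h0
      have hs : s = 0 := by
        by_contra hs
        have hy : q 1 = 0 := by
          rcases mul_eq_zero.mp h1 with h | h
          · exact absurd h hs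
          · exact (mul_eq_zero.mp h).resolve_left two_ne_zero
        have hf := fderiv_ne_zero_of_y_eq_zero L hcub hy
        rcases mul_eq_zero.mp h0 with h | h
        · exact hs h
        · exact hf (neg_eq_zero.mp h)
      exact ⟨hs, ht⟩
    rw [hfun, finrank_span_eq_card hli]
    rfl
  not_isolated q hq := by
    obtain ⟨z₀, hz₀, hne, rfl⟩ := exists_psiT_eq L v hq
    have hev1 := eventually_shift_notMem L hz₀
    have hev2 := eventually_shift_ne L v hz₀ hne
    -- one of the first two coordinates of `ψ_v(z₀ + t)` moves
    have hev3 : ∀ᶠ t : ℝ in 𝓝[≠] 0, psiT L v (z₀ + (t : ℂ)) ≠ psiT L v z₀ := by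
      by_cases h2 : ℘'[L] z₀ = 0
      · -- `y` moves: `d/dt ℘′(z₀ + t)/2 = ℘″(z₀)/2 ≠ 0` at a `2`-torsion point
        have hq := psiT_mem_points L v hz₀ hne
        rw [mem_points_curveT_iff] at hq
        have hf : 3 * ℘[L] z₀ ^ 2 + A L ≠ 0 :=
          fderiv_ne_zero_of_y_eq_zero L (q := psiT L v z₀) hq.1 (by simp [h2])
        have hd : HasDerivAt (fun t : ℝ => ℘'[L] (z₀ + (t : ℂ)) / 2) (3 * ℘[L] z₀ ^ 2 - L.g₂ / 4) 0 := by
          have h := hasDerivAt_psiT_shift L v z₀ (t := 0) (by simpa using hz₀) (by simpa using hne) 1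
          simpa using h
        have hne' : 3 * ℘[L] z₀ ^ 2 - L.g₂ / 4 ≠ 0 := by
          have e : 3 * ℘[L] z₀ ^ 2 - L.g₂ / 4 = 3 * ℘[L] z₀ ^ 2 + A L := by rw [A]; ring
          rwa [e]
        filter_upwards [hd.eventually_ne hne'] with t ht h
        have h1 : ℘'[L] (z₀ + (t : ℂ)) / 2 = ℘'[L] z₀ / 2 := congrFun h 1
        apply ht
        show ℘'[L] (z₀ + (t : ℂ)) / 2 = ℘'[L] (z₀ + ((0 : ℝ) : ℂ)) / 2
        rw [h1, ofReal_zero, add_zero]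
      · have hd : HasDerivAt (fun t : ℝ => ℘[L] (z₀ + (t : ℂ))) (℘'[L] z₀) 0 := by
          have h := hasDerivAt_psiT_shift L v z₀ (t := 0) (by simpa using hz₀) (by simpa using hne) 0
          simpa using h
        filter_upwards [hd.eventually_ne h2] with t ht h
        have h0 : ℘[L] (z₀ + (t : ℂ)) = ℘[L] z₀ := congrFun h 0
        apply ht
        show ℘[L] (z₀ + (t : ℂ)) = ℘[L] (z₀ + ((0 : ℝ) : ℂ))
        rw [h0, ofReal_zero, add_zero]
    have hcont : Tendsto (fun t : ℝ => psiT L v (z₀ + (t : ℂ))) (𝓝 0) (𝓝 (psiT L v z₀)) := by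
      rw [tendsto_pi_nhds]
      intro k
      have h := (hasDerivAt_psiT_shift L v z₀ (t := 0) (by simpa using hz₀) (by simpa using hne)
        k).continuousAt.tendsto
      simpa using h
    refine mem_closure_of_tendsto (b := 𝓝[≠] (0 : ℝ)) (f := fun t : ℝ => psiT L v (z₀ + (t : ℂ)))
      (hcont.mono_left nhdsWithin_le_nhds) ?_
    filter_upwards [mem_nhdsWithin_of_mem_nhds hev1, mem_nhdsWithin_of_mem_nhds hev2, hev3]
      with t ht1 ht2 ht3
    exact ⟨psiT_mem_points L v ht1 ht2, ht3⟩

/-! ### The tangent line of `Z_v` at `ψ_v(z)` is spanned by `ψ_v′(z)` -/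

/-- At `ψ_v(z)` every tangent vector of `Z_v` is a multiple of `ψ_v′(z)` (the tangent space of a
smooth affine curve is a line, `tangent_parallel`; `ψ_v′(z) ≠ 0`: its first coordinate is `℘′(z)`,
its second `f′(℘(z)) ≠ 0` where `℘′(z) = 0`). [folklore] -/
theorem exists_eq_smul_psiTD (hE : (curveT L v).IsSmoothAffineCurve) {z : ℂ} (hz : z ∉ L.lattice)
    (hne : ℘[L] z ≠ ℘[L] v) {t : Fin 3 → ℂ} (ht : t ∈ (curveT L v).tangentSpace (psiT L v z)) :
    ∃ c : ℂ, t = c • psiTD L v z := by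
  have hpar := tangent_parallel hE (psiT_mem_points L v hz hne) ht (psiTD_mem_tangentSpace L v hne)
  by_cases h2 : ℘'[L] z = 0
  · have hq := psiT_mem_points L v hz hne
    rw [mem_points_curveT_iff] at hq
    have hf : 3 * ℘[L] z ^ 2 + A L ≠ 0 :=
      fderiv_ne_zero_of_y_eq_zero L (q := psiT L v z) hq.1 (by simp [h2])
    have hne1 : psiTD L v z 1 ≠ 0 := by
      rw [psiTD_apply_one]
      have e : 3 * ℘[L] z ^ 2 - L.g₂ / 4 = 3 * ℘[L] z ^ 2 + A L := by rw [A]; ring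
      rwa [e]
    refine ⟨t 1 / psiTD L v z 1, funext fun j => ?_⟩
    have h := hpar 1 j
    simp only [Pi.smul_apply, smul_eq_mul]
    field_simp
    linear_combination h
  · have hne0 : psiTD L v z 0 ≠ 0 := by rwa [psiTD_apply_zero]
    refine ⟨t 0 / psiTD L v z 0, funext fun j => ?_⟩
    have h := hpar 0 j
    simp only [Pi.smul_apply, smul_eq_mul]
    field_simp
    linear_combination h

/-- **A form vanishes on `Z_v` as soon as it kills `ψ_v′(z)` at every `ψ_v(z)`.** [folklore] -/
theorem vanishesOn_curveT_of_psi (hE : (curveT L v).IsSmoothAffineCurve)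
    (ν : Fin 3 → MvPolynomial (Fin 3) ℂ)
    (h : ∀ z, z ∉ L.lattice → ℘[L] z ≠ ℘[L] v → ∑ i, eval (psiT L v z) (ν i) * psiTD L v z i = 0) :
    VanishesOn (curveT L v) ν := by
  intro q hq t ht
  obtain ⟨z, hz, hne, rfl⟩ := exists_psiT_eq L v hq
  obtain ⟨c, rfl⟩ := exists_eq_smul_psiTD L v hE hz hne ht
  simp only [Pi.smul_apply, smul_eq_mul]
  have e : ∑ i, eval (psiT L v z) (ν i) * (c * psiTD L v z i) =
      c * ∑ i, eval (psiT L v z) (ν i) * psiTD L v z i := by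
    rw [Finset.mul_sum]
    refine Finset.sum_congr rfl fun i _ => ?_
    ring
  rw [e, h z hz hne, mul_zero]

/-! ### The maps `ι = (x, y)` and `tra = τ_P` as polynomial maps `Z_v → E_L` -/

/-- The chord slope `λ = (y − y_P) w` (`= (y − y_P)/(x − x_P)` on `Z_v`), `y_P = ℘′(v)/2`.
[cite: SilvermanAEC2009, III.2.3] -/
def lam : MvPolynomial (Fin 3) ℂ := (X 1 - C (℘'[L] v / 2)) * X 2

/-- `x(P + Q) = λ² − x − x_P`. [cite: SilvermanAEC2009, III.2.3] -/
def traX : MvPolynomial (Fin 3) ℂ := lam L v ^ 2 - X 0 - C (℘[L] v)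

/-- `y(P + Q) = λ (x − x(P+Q)) − y`. [cite: SilvermanAEC2009, III.2.3] -/
def traY : MvPolynomial (Fin 3) ℂ := lam L v * (X 0 - traX L v) - X 1

/-- **The translation map** `tra = (x(P + Q), y(P + Q)) : Z_v → E_L`, `Q = (x, y)`, `P = φ(v)`.
[cite: SilvermanAEC2009, III.2.3] -/
def tra : Fin 2 → MvPolynomial (Fin 3) ℂ := ![traX L v, traY L v]

/-- `R = −2λ`, the exact part of `tra^*(x dx/y) − x dx/y` (from
`ζ(z + v) = ζ(z) + ζ(v) + λ(ψ_v(z))`). [folklore] -/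
def rPolyT : MvPolynomial (Fin 3) ℂ := C (-2 : ℂ) * lam L v

section Alg

variable {v}
variable (hv : IsAlgPt L v)
include hv

/-- `λ` is over `ℚ̄` (for an algebraic point `P = φ(v)`). [folklore] -/
theorem hasAlgCoeffs_lam : HasAlgCoeffs (lam L v) :=
  ((hasAlgCoeffs_X 1).sub (hasAlgCoeffs_C (by simpa using hv.2 1))).mul (hasAlgCoeffs_X 2)

/-- `x(P + Q)` is over `ℚ̄`. [folklore] -/
theorem hasAlgCoeffs_traX : HasAlgCoeffs (traX L v) :=
  (((hasAlgCoeffs_lam L hv).pow 2).sub (hasAlgCoeffs_X 0)).sub (hasAlgCoeffs_C hv.weierstrassP)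

/-- `y(P + Q)` is over `ℚ̄`. [folklore] -/
theorem hasAlgCoeffs_traY : HasAlgCoeffs (traY L v) :=
  ((hasAlgCoeffs_lam L hv).mul ((hasAlgCoeffs_X 0).sub (hasAlgCoeffs_traX L hv))).sub
    (hasAlgCoeffs_X 1)

/-- `tra` is over `ℚ̄`. [folklore] -/
theorem hasAlgCoeffs_tra : ∀ j, HasAlgCoeffs (tra L v j) := by
  intro j
  fin_cases j
  · simpa [tra] using hasAlgCoeffs_traX L hv
  · simpa [tra] using hasAlgCoeffs_traY L hv

/-- `R` is over `ℚ̄`. [folklore] -/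
theorem hasAlgCoeffs_rPolyT : HasAlgCoeffs (rPolyT L v) :=
  (hasAlgCoeffs_C (isAlgebraic_int 2).neg).mul (hasAlgCoeffs_lam L hv)

end Alg

/-- `ι(ψ_v(z)) = φ(z)`. [folklore] -/
theorem iota_psiT (z : ℂ) : (fun j => eval (psiT L v z) (iota j)) = phi L z := by
  rw [iota_eval]
  rfl

/-- `λ(ψ_v(z)) = ½ (℘′(z) − ℘′(v))/(℘(z) − ℘(v))`. [folklore] -/
theorem eval_lam_psiT {z : ℂ} (hne : ℘[L] z ≠ ℘[L] v) :
    eval (psiT L v z) (lam L v) = (℘'[L] z - ℘'[L] v) / (℘[L] z - ℘[L] v) / 2 := by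
  have hD : ℘[L] z - ℘[L] v ≠ 0 := sub_ne_zero.2 hne
  simp only [lam, map_mul, map_sub, eval_X, eval_C, psiT_apply_one, psiT_apply_two]
  field_simp

/-- **`x(P + Q)` along `ψ_v` is `℘(z + v)`** (addition theorem for `℘`,
`PeriodPair.weierstrassP_add_holds`). [cite: ArmitageEberlein2001, §7.4.2 Thm. 7.2] -/
theorem eval_traX_psiT {z : ℂ} (hz : z ∉ L.lattice) (hv : v ∉ L.lattice) (hne : ℘[L] z ≠ ℘[L] v) :
    eval (psiT L v z) (traX L v) = ℘[L] (z + v) := by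
  rw [L.weierstrassP_add_holds z v hz hv hne]
  simp only [traX, map_sub, map_pow, eval_C, eval_X, eval_lam_psiT L v hne, psiT_apply_zero]
  ring

/-- **`y(P + Q)` along `ψ_v` is `℘′(z + v)/2`** (addition theorem for `℘′`,
`PeriodPair.derivWeierstrassP_add_of_ne`). [cite: SilvermanAEC2009, III.2.3 (c)] -/
theorem eval_traY_psiT {z : ℂ} (hz : z ∉ L.lattice) (hv : v ∉ L.lattice) (hne : ℘[L] z ≠ ℘[L] v) :
    eval (psiT L v z) (traY L v) = ℘'[L] (z + v) / 2 := by
  rw [PeriodPair.derivWeierstrassP_add_of_ne hz hv hne]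
  simp only [traY, map_sub, map_mul, eval_X, eval_traX_psiT L v hz hv hne, eval_lam_psiT L v hne,
    psiT_apply_zero, psiT_apply_one]
  ring

/-- **`tra(ψ_v(z)) = φ(z + v)`**. [cite: SilvermanAEC2009, III.2.3] -/
theorem tra_psiT {z : ℂ} (hz : z ∉ L.lattice) (hv : v ∉ L.lattice) (hne : ℘[L] z ≠ ℘[L] v) :
    (fun j => eval (psiT L v z) (tra L v j)) = phi L (z + v) := by
  funext j
  fin_cases j
  · simpa [tra] using eval_traX_psiT L v hz hv hne
  · simpa [tra] using eval_traY_psiT L v hz hv hne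

/-- `ι` maps `Z_v` into `E_L`. [folklore] -/
theorem iota_mapsTo_T : ∀ q ∈ (curveT L v).points, (fun j => eval q (iota j)) ∈ (curve L).points := by
  intro q hq
  rw [iota_eval, Weier.mem_points_iff, Weier.eval_fPoly]
  rw [mem_points_curveT_iff] at hq
  simpa using hq.1

/-- `℘(z) ≠ ℘(v)` forces `z + v ∉ Λ`. [folklore] -/
theorem add_notMem_of_ne {z : ℂ} (hz : z ∉ L.lattice) (hv : v ∉ L.lattice) (hne : ℘[L] z ≠ ℘[L] v) :
    z + v ∉ L.lattice := fun h =>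
  hne ((L.weierstrassP_eq_weierstrassP_iff hz hv).2 (Or.inl h))

/-- `tra` maps `Z_v` into `E_L` (`φ(z + v) ∈ E_L`). [folklore] -/
theorem tra_mapsTo (hv : v ∉ L.lattice) :
    ∀ q ∈ (curveT L v).points, (fun j => eval q (tra L v j)) ∈ (curve L).points := by
  intro q hq
  obtain ⟨z, hz, hne, rfl⟩ := exists_psiT_eq L v hq
  rw [tra_psiT L v hz hv hne]
  exact phi_mem_points L (add_notMem_of_ne L v hz hv hne)

/-! ### Directional derivatives along `ψ_v` -/

/-- `Dι(ψ_v(z)) ψ_v′(z) = φ′(z)`. [folklore] -/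
theorem pair_pderiv_iota_T (z : ℂ) (j : Fin 2) :
    ∑ i, eval (psiT L v z) (pderiv i (iota j)) * psiTD L v z i = phiD L z j := by
  fin_cases j <;> simp [iota, Pi.single_apply]

/-- The derivative of a polynomial along `t ↦ ψ_v(z + t)` at `t = 0`. [folklore] -/
theorem hasDerivAt_eval_psiT_shift {z : ℂ} (hz : z ∉ L.lattice) (hne : ℘[L] z ≠ ℘[L] v)
    (P : MvPolynomial (Fin 3) ℂ) :
    HasDerivAt (fun t : ℝ => eval (psiT L v (z + t)) P)
      (∑ i, eval (psiT L v z) (pderiv i P) * psiTD L v z i) 0 := by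
  have h := hasDerivAt_eval_comp (γ := fun t : ℝ => psiT L v (z + t)) (γ' := psiTD L v z) (t := 0)
    (fun i => by
      have h := hasDerivAt_psiT_shift L v z (t := 0) (by simpa using hz) (by simpa using hne) i
      simpa using h) P
  simpa using h

/-- **`D(tra)(ψ_v(z)) ψ_v′(z) = φ′(z + v)`**: the derivative at `t = 0` of
`t ↦ tra(ψ_v(z + t)) = φ(z + v + t)`. [folklore] -/
theorem pair_pderiv_tra {z : ℂ} (hz : z ∉ L.lattice) (hv : v ∉ L.lattice) (hne : ℘[L] z ≠ ℘[L] v)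
    (j : Fin 2) :
    ∑ i, eval (psiT L v z) (pderiv i (tra L v j)) * psiTD L v z i = phiD L (z + v) j := by
  have hD := hasDerivAt_eval_psiT_shift L v hz hne (tra L v j)
  have hE : (fun t : ℝ => phi L (z + v + t * 1) j) =ᶠ[𝓝 0]
      fun t : ℝ => eval (psiT L v (z + t)) (tra L v j) := by
    filter_upwards [eventually_shift_notMem L hz, eventually_shift_ne L v hz hne] with t ht1 ht2
    have h := congrFun (tra_psiT L v ht1 hv ht2) j
    rw [h, show z + v + (t : ℂ) * 1 = z + t + v by ring]
  have hD2 : HasDerivAt (fun t : ℝ => phi L (z + v + t * 1) j)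
      (phiD L (z + v + ((0 : ℝ) : ℂ) * 1) j * 1) 0 :=
    hasDerivAt_phi_line L (z + v) 1 (by simpa using add_notMem_of_ne L v hz hv hne) j
  have h := hD.unique (hD2.congr_of_eventuallyEq hE.symm)
  rw [h]
  simp

/-- `λ(ψ_v(u)) = ζ(u + v) − ζ(u) − ζ(v)` (the addition theorem for `ζ`,
`PeriodPair.weierstrassZeta_add_holds`). [cite: ArmitageEberlein2001, §7.4.2] -/
theorem eval_lam_psiT_eq_zeta {u : ℂ} (hu : u ∉ L.lattice) (hv : v ∉ L.lattice)
    (hne : ℘[L] u ≠ ℘[L] v) :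
    eval (psiT L v u) (lam L v) =
      L.weierstrassZeta (u + v) - L.weierstrassZeta u - L.weierstrassZeta v := by
  rw [eval_lam_psiT L v hne, L.weierstrassZeta_add_holds u v hu hv hne]
  ring

/-- **`DR(ψ_v(z)) ψ_v′(z) = 2℘(z + v) − 2℘(z)`** (`R = −2λ = −2(ζ(· + v) − ζ − ζ(v))` along
`ψ_v`, and `ζ′ = −℘`). [folklore] -/
theorem pair_pderiv_rPolyT {z : ℂ} (hz : z ∉ L.lattice) (hv : v ∉ L.lattice)
    (hne : ℘[L] z ≠ ℘[L] v) :
    ∑ i, eval (psiT L v z) (pderiv i (rPolyT L v)) * psiTD L v z i =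
      2 * ℘[L] (z + v) - 2 * ℘[L] z := by
  have hD := hasDerivAt_eval_psiT_shift L v hz hne (rPolyT L v)
  have hzv : z + v ∉ L.lattice := add_notMem_of_ne L v hz hv hne
  -- `ζ′ = −℘` off the lattice
  have hζ : ∀ w, w ∉ L.lattice → HasDerivAt L.weierstrassZeta (-℘[L] w) w := fun w hw => by
    have hd : DifferentiableAt ℂ L.weierstrassZeta w :=
      L.differentiableOn_weierstrassZeta_holds.differentiableAt
        (L.isClosed_lattice.isOpen_compl.mem_nhds hw)
    rw [← L.deriv_weierstrassZeta_holds w hw]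
    exact hd.hasDerivAt
  have hE : (fun t : ℝ => -2 * (L.weierstrassZeta (z + v + t) - L.weierstrassZeta (z + t) -
      L.weierstrassZeta v)) =ᶠ[𝓝 0] fun t : ℝ => eval (psiT L v (z + t)) (rPolyT L v) := by
    filter_upwards [eventually_shift_notMem L hz, eventually_shift_ne L v hz hne] with t ht1 ht2
    rw [rPolyT, map_mul, eval_C, eval_lam_psiT_eq_zeta L v ht1 hv ht2]
    congr 2
    ring
  have hD2 : HasDerivAt (fun t : ℝ => -2 * (L.weierstrassZeta (z + v + t) -
      L.weierstrassZeta (z + t) - L.weierstrassZeta v))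
      (-2 * (-℘[L] (z + v) * 1 - -℘[L] z * 1)) 0 := by
    have h1 : HasDerivAt (fun t : ℝ => L.weierstrassZeta (z + v + t)) (-℘[L] (z + v) * 1) 0 := by
      have hin : HasDerivAt (fun s : ℂ => z + v + s) 1 ((0 : ℝ) : ℂ) := by
        simpa using (hasDerivAt_id (((0 : ℝ) : ℂ))).const_add (z + v)
      have h := ((hζ _ (by simpa using hzv)).comp ((0 : ℝ) : ℂ) hin).comp_ofReal
      simpa using h
    have h2 : HasDerivAt (fun t : ℝ => L.weierstrassZeta (z + t)) (-℘[L] z * 1) 0 := by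
      have hin : HasDerivAt (fun s : ℂ => z + s) 1 ((0 : ℝ) : ℂ) := by
        simpa using (hasDerivAt_id (((0 : ℝ) : ℂ))).const_add z
      have h := ((hζ _ (by simpa using hz)).comp ((0 : ℝ) : ℂ) hin).comp_ofReal
      simpa using h
    exact ((h1.sub h2).sub_const _).const_mul (-2)
  have h := hD.unique (hD2.congr_of_eventuallyEq hE.symm)
  rw [h]
  ring

/-! ### The identities of forms on `Z_v` -/

/-- `ν₀ = tra^*θ₀ − ι^*θ₀`. [folklore] -/
def nuT0 : Fin 3 → MvPolynomial (Fin 3) ℂ :=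
  formPullback (tra L v) (theta0 L) - formPullback iota (theta0 L)

/-- `ν₁ = tra^*θ₁ − ι^*θ₁ − dR`. [folklore] -/
def nuT1 : Fin 3 → MvPolynomial (Fin 3) ℂ :=
  formPullback (tra L v) (theta1 L) - formPullback iota (theta1 L) - formD (rPolyT L v)

/-- **`tra^*θ₀ = ι^*θ₀` on `Z_v`** (`τ_P^* dz = dz`: the invariant differential): `ν₀` vanishes
on `Z_v`. [cite: HuberWustholz2022, §18.1 (p. 160)] [cite: SilvermanAEC2009, III.5.1] -/
theorem vanishesOn_nuT0 (hE : (curveT L v).IsSmoothAffineCurve) (hv : v ∉ L.lattice) :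
    VanishesOn (curveT L v) (nuT0 L v) := by
  refine vanishesOn_curveT_of_psi L v hE _ fun z hz hne => ?_
  have hzv : z + v ∉ L.lattice := add_notMem_of_ne L v hz hv hne
  have e : ∀ i, eval (psiT L v z) (nuT0 L v i) * psiTD L v z i =
      eval (psiT L v z) (formPullback (tra L v) (theta0 L) i) * psiTD L v z i -
        eval (psiT L v z) (formPullback iota (theta0 L) i) * psiTD L v z i := fun i => by
    simp only [nuT0, Pi.sub_apply, map_sub]
    ring
  rw [Finset.sum_congr rfl fun i _ => e i, Finset.sum_sub_distrib, formPullback_pair,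
    formPullback_pair, tra_psiT L v hz hv hne, iota_psiT]
  have hs1 : ∑ j, eval (phi L (z + v)) (theta0 L j) *
      (∑ i, eval (psiT L v z) (pderiv i (tra L v j)) * psiTD L v z i) =
      ∑ j, eval (phi L (z + v)) (theta0 L j) * phiD L (z + v) j :=
    Finset.sum_congr rfl fun j _ => by rw [pair_pderiv_tra L v hz hv hne j]
  have hs2 : ∑ j, eval (phi L z) (theta0 L j) *
      (∑ i, eval (psiT L v z) (pderiv i (iota j)) * psiTD L v z i) =
      ∑ j, eval (phi L z) (theta0 L j) * phiD L z j :=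
    Finset.sum_congr rfl fun j _ => by rw [pair_pderiv_iota_T L v z j]
  rw [hs1, hs2, theta0_phi L hzv, theta0_phi L hz, sub_self]

/-- **`tra^*θ₁ = ι^*θ₁ + dR` on `Z_v`** (`τ_P^*(℘ dz) = ℘ dz − dλ`, i.e.
`ζ(z + v) = ζ(z) + ζ(v) + λ`): `ν₁` vanishes on `Z_v`. [cite: HuberWustholz2022, §18.1 (p. 160)] -/
theorem vanishesOn_nuT1 (hE : (curveT L v).IsSmoothAffineCurve) (hv : v ∉ L.lattice) :
    VanishesOn (curveT L v) (nuT1 L v) := by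
  refine vanishesOn_curveT_of_psi L v hE _ fun z hz hne => ?_
  have hzv : z + v ∉ L.lattice := add_notMem_of_ne L v hz hv hne
  have e : ∀ i, eval (psiT L v z) (nuT1 L v i) * psiTD L v z i =
      eval (psiT L v z) (formPullback (tra L v) (theta1 L) i) * psiTD L v z i -
        eval (psiT L v z) (formPullback iota (theta1 L) i) * psiTD L v z i -
        eval (psiT L v z) (pderiv i (rPolyT L v)) * psiTD L v z i := fun i => by
    simp only [nuT1, formD, Pi.sub_apply, map_sub]
    ring
  rw [Finset.sum_congr rfl fun i _ => e i, Finset.sum_sub_distrib, Finset.sum_sub_distrib,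
    formPullback_pair, formPullback_pair, tra_psiT L v hz hv hne, iota_psiT,
    pair_pderiv_rPolyT L v hz hv hne]
  have hs1 : ∑ j, eval (phi L (z + v)) (theta1 L j) *
      (∑ i, eval (psiT L v z) (pderiv i (tra L v j)) * psiTD L v z i) =
      ∑ j, eval (phi L (z + v)) (theta1 L j) * phiD L (z + v) j :=
    Finset.sum_congr rfl fun j _ => by rw [pair_pderiv_tra L v hz hv hne j]
  have hs2 : ∑ j, eval (phi L z) (theta1 L j) *
      (∑ i, eval (psiT L v z) (pderiv i (iota j)) * psiTD L v z i) =
      ∑ j, eval (phi L z) (theta1 L j) * phiD L z j :=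
    Finset.sum_congr rfl fun j _ => by rw [pair_pderiv_iota_T L v z j]
  rw [hs1, hs2, theta1_phi L hzv, theta1_phi L hz]
  ring

/-! ### Algebraic points and the lifted path `ψ_v ∘ g` on `Z_v` -/

variable {v}

/-- The coordinates of `ψ_v(z)` are algebraic at an algebraic point `z` (for `℘(v) ∈ ℚ̄`).
[folklore] -/
theorem IsAlgPt.psiT {z : ℂ} (hz : IsAlgPt L z) (hv : IsAlgPt L v) :
    ∀ k, IsAlgebraic ℚ (psiT L v z k) := by
  intro k
  fin_cases k
  · simpa using hz.2 0
  · simpa using hz.2 1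
  · simpa using (hz.weierstrassP.sub hv.weierstrassP).inv

/-- **`z + v` is an algebraic point if `z` and `v` are** (and `℘(z) ≠ ℘(v)`): `φ(z + v) =
tra(ψ_v(z))` with `tra` over `ℚ̄` — the group law is defined over `ℚ̄`. [folklore] -/
theorem IsAlgPt.add_of_ne {z : ℂ} (hz : IsAlgPt L z) (hv : IsAlgPt L v) (hne : ℘[L] z ≠ ℘[L] v) :
    IsAlgPt L (z + v) := by
  refine ⟨add_notMem_of_ne L v hz.1 hv.1 hne, fun k => ?_⟩
  rw [← congrFun (tra_psiT L v hz.1 hv.1 hne) k]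
  exact (hasAlgCoeffs_tra L hv k).isAlgebraic_eval (IsAlgPt.psiT L hz hv)

/-- `R(ψ_v(z)) ∈ ℚ̄` at an algebraic point. [folklore] -/
theorem isAlgebraic_eval_rPolyT {z : ℂ} (hz : IsAlgPt L z) (hv : IsAlgPt L v) :
    IsAlgebraic ℚ (eval (psiT L v z) (rPolyT L v)) :=
  (hasAlgCoeffs_rPolyT L hv).isAlgebraic_eval (IsAlgPt.psiT L hz hv)

variable (v) in
/-- `R(ψ_v(z)) = −2 (ζ(z + v) − ζ(z) − ζ(v))`. [cite: ArmitageEberlein2001, §7.4.2] -/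
theorem eval_rPolyT_psiT {z : ℂ} (hz : z ∉ L.lattice) (hv : v ∉ L.lattice) (hne : ℘[L] z ≠ ℘[L] v) :
    eval (psiT L v z) (rPolyT L v) =
      -2 * (L.weierstrassZeta (z + v) - L.weierstrassZeta z - L.weierstrassZeta v) := by
  rw [rPolyT, map_mul, eval_C, eval_lam_psiT_eq_zeta L v hz hv hne]

/-- **The lifted path `ψ_v ∘ g` on `Z_v`**, for a `C¹` map `g` whose values on `[0,1]` avoid `Λ`
and `±v + Λ` (`℘(g(t)) ≠ ℘(v)`), with algebraic end points. [folklore] -/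
def liftPathT (hv : IsAlgPt L v) (g : ℝ → ℂ) (hg : ContDiff ℝ 1 g)
    (hΛ : ∀ t ∈ Icc (0 : ℝ) 1, g t ∉ L.lattice)
    (hne : ∀ t ∈ Icc (0 : ℝ) 1, ℘[L] (g t) ≠ ℘[L] v)
    (h0 : IsAlgPt L (g 0)) (h1 : IsAlgPt L (g 1)) : CurvePath (curveT L v) where
  toFun t := psiT L v (g t)
  contDiffOn := by
    have hφ : ∀ k : Fin 2, ContDiffOn ℝ 1 (fun t => phi L (g t) k) (Icc 0 1) := fun k =>
      (contDiffOn_phi L k).comp hg.contDiffOn fun t ht => hΛ t ht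
    have hx := hφ 0
    have hy := hφ 1
    simp only [phi_apply_zero, phi_apply_one] at hx hy
    refine contDiffOn_pi.2 fun k => ?_
    fin_cases k
    · exact hx
    · exact hy
    · exact (hx.sub contDiffOn_const).inv fun t ht => sub_ne_zero.2 (hne t ht)
  mem_points t ht := psiT_mem_points L v (hΛ t ht) (hne t ht)
  algebraic_zero k := by simpa using IsAlgPt.psiT L h0 hv k
  algebraic_one k := by simpa using IsAlgPt.psiT L h1 hv k

/-- The parametrisation of `liftPathT`. [folklore] -/
@[simp] theorem liftPathT_toFun (hv : IsAlgPt L v) (g : ℝ → ℂ) (hg : ContDiff ℝ 1 g)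
    (hΛ : ∀ t ∈ Icc (0 : ℝ) 1, g t ∉ L.lattice)
    (hne : ∀ t ∈ Icc (0 : ℝ) 1, ℘[L] (g t) ≠ ℘[L] v)
    (h0 : IsAlgPt L (g 0)) (h1 : IsAlgPt L (g 1)) (t : ℝ) :
    (liftPathT L hv g hg hΛ hne h0 h1).toFun t = psiT L v (g t) := rfl

/-! ### Translation by an algebraic point does not change the symbol -/

section Translate

variable (h₂ : IsAlgebraic ℚ L.g₂) (h₃ : IsAlgebraic ℚ L.g₃)
include h₂ h₃

/-- **Translation invariance for `θ₀ = dx/y`.** Let `P = φ(v)` be an algebraic point and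
`g : [0,1] → ℂ` a `C¹` map avoiding `Λ` and `±v + Λ` with algebraic end points. Then
`(E_L, θ₀, φ∘(g + v)) − (E_L, θ₀, φ∘g)` lies in the `ℚ̄`-span of the elementary relations:
functoriality (R4) along the translation `τ_P : Z_v → E_L` and along `ι : Z_v → E_L`, with
`τ_P^*θ₀ = ι^*θ₀` in `Ω¹(Z_v)` (the invariant differential). This is the relation behind the
additivity `∫_O^{P+Q} dx/y = ∫_O^P dx/y + ∫_O^Q dx/y (mod periods)` of elliptic integrals of the
first kind. [cite: HuberWustholz2022, §13.1 (B) (p. 120), §18.1 (p. 160)] [cite: SilvermanAEC2009, III.5.1] -/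
theorem span_translate_theta0 (hv : IsAlgPt L v) {g : ℝ → ℂ} (hg : ContDiff ℝ 1 g)
    (hΛ : ∀ t ∈ Icc (0 : ℝ) 1, g t ∉ L.lattice)
    (hne : ∀ t ∈ Icc (0 : ℝ) 1, ℘[L] (g t) ≠ ℘[L] v)
    (h0 : IsAlgPt L (g 0)) (h1 : IsAlgPt L (g 1))
    (hg' : ContDiff ℝ 1 fun t => g t + v)
    (hΛ' : ∀ t ∈ Icc (0 : ℝ) 1, g t + v ∉ L.lattice)
    (h0' : IsAlgPt L (g 0 + v)) (h1' : IsAlgPt L (g 1 + v)) :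
    InSpan (Finsupp.single (⟨curve L, smooth L h₂ h₃, theta0 L, hasAlgCoeffs_theta0 L h₂ h₃,
        liftPath L (fun t => g t + v) hg' hΛ' h0' h1'⟩ : PeriodSymbol) (1 : ℂ) -
      Finsupp.single (⟨curve L, smooth L h₂ h₃, theta0 L, hasAlgCoeffs_theta0 L h₂ h₃,
        liftPath L g hg hΛ h0 h1⟩ : PeriodSymbol) 1) := by
  have hE := smooth L h₂ h₃
  have hET := smoothT L v h₂ h₃ hv.weierstrassP
  have hθ := hasAlgCoeffs_theta0 L h₂ h₃
  have hιθ : ∀ i, HasAlgCoeffs (formPullback iota (theta0 L) i) :=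
    HasAlgCoeffs.formPullback hasAlgCoeffs_iota hθ
  have htθ : ∀ i, HasAlgCoeffs (formPullback (tra L v) (theta0 L) i) :=
    HasAlgCoeffs.formPullback (hasAlgCoeffs_tra L hv) hθ
  have hν : ∀ i, HasAlgCoeffs (nuT0 L v i) := fun i => (htθ i).sub (hιθ i)
  set Γ := liftPathT L hv g hg hΛ hne h0 h1 with hΓ
  have rι := IsElementaryRelation.pushforward (curveT L v) (curve L) hET hE iota hasAlgCoeffs_iota
    (iota_mapsTo_T L v) (theta0 L) hθ (formPullback iota (theta0 L)) hιθ rfl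
    Γ (liftPath L g hg hΛ h0 h1) (fun t _ => by
      rw [iota_eval, liftPath_toFun, hΓ, liftPathT_toFun]
      rfl)
  have rt := IsElementaryRelation.pushforward (curveT L v) (curve L) hET hE (tra L v)
    (hasAlgCoeffs_tra L hv) (tra_mapsTo L v hv.1) (theta0 L) hθ (formPullback (tra L v) (theta0 L))
    htθ rfl Γ (liftPath L (fun t => g t + v) hg' hΛ' h0' h1') (fun t ht => by
      rw [liftPath_toFun, hΓ, liftPathT_toFun, tra_psiT L v (hΛ t ht) hv.1 (hne t ht)])
  have radd := IsElementaryRelation.add (curveT L v) hET Γ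
    (formPullback (tra L v) (theta0 L)) (formPullback iota (theta0 L)) (nuT0 L v) htθ hιθ hν
    (by rw [nuT0, add_sub_cancel])
  have rvan := IsElementaryRelation.vanish (curveT L v) hET Γ (nuT0 L v) hν
    (vanishesOn_nuT0 L v hET hv.1)
  obtain ⟨k, ρ, cf, hρ, hcf, hsum⟩ :=
    span_add (span_add (span_sub (span_of_rel rι) (span_of_rel rt)) (span_of_rel radd))
      (span_of_rel rvan)
  refine ⟨k, ρ, cf, hρ, hcf, ?_⟩
  rw [← hsum]
  abel

/-- **Translation invariance for `θ₁ = x dx/y`, up to an algebraic constant.** With the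
notation of `span_translate_theta0`,
`(E_L, θ₁, φ∘(g + v)) − (E_L, θ₁, φ∘g) − (R(ψ_v(g 1)) − R(ψ_v(g 0))) · 𝟙` lies in the span,
where `R = −2λ`, `R(ψ_v(z)) = −2(ζ(z + v) − ζ(z) − ζ(v)) ∈ ℚ̄` at algebraic `z`
(`τ_P^*θ₁ = ι^*θ₁ + dR` in `Ω¹(Z_v)`; (R3) for `dR`). This is the relation behind the addition
formula for elliptic integrals of the second kind.
[cite: HuberWustholz2022, §13.1 (B) (p. 120), §18.1 (p. 160)] [cite: ArmitageEberlein2001, §7.4.2] -/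
theorem span_translate_theta1 (hv : IsAlgPt L v) {g : ℝ → ℂ} (hg : ContDiff ℝ 1 g)
    (hΛ : ∀ t ∈ Icc (0 : ℝ) 1, g t ∉ L.lattice)
    (hne : ∀ t ∈ Icc (0 : ℝ) 1, ℘[L] (g t) ≠ ℘[L] v)
    (h0 : IsAlgPt L (g 0)) (h1 : IsAlgPt L (g 1))
    (hg' : ContDiff ℝ 1 fun t => g t + v)
    (hΛ' : ∀ t ∈ Icc (0 : ℝ) 1, g t + v ∉ L.lattice)
    (h0' : IsAlgPt L (g 0 + v)) (h1' : IsAlgPt L (g 1 + v)) :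
    InSpan (Finsupp.single (⟨curve L, smooth L h₂ h₃, theta1 L, hasAlgCoeffs_theta1 L h₂ h₃,
        liftPath L (fun t => g t + v) hg' hΛ' h0' h1'⟩ : PeriodSymbol) (1 : ℂ) -
      Finsupp.single (⟨curve L, smooth L h₂ h₃, theta1 L, hasAlgCoeffs_theta1 L h₂ h₃,
        liftPath L g hg hΛ h0 h1⟩ : PeriodSymbol) 1 -
      (eval (psiT L v (g 1)) (rPolyT L v) - eval (psiT L v (g 0)) (rPolyT L v)) •
        Finsupp.single PeriodSymbol.unit (1 : ℂ)) := by
  have hE := smooth L h₂ h₃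
  have hET := smoothT L v h₂ h₃ hv.weierstrassP
  have hθ := hasAlgCoeffs_theta1 L h₂ h₃
  have hR := hasAlgCoeffs_rPolyT L hv
  have hιθ : ∀ i, HasAlgCoeffs (formPullback iota (theta1 L) i) :=
    HasAlgCoeffs.formPullback hasAlgCoeffs_iota hθ
  have htθ : ∀ i, HasAlgCoeffs (formPullback (tra L v) (theta1 L) i) :=
    HasAlgCoeffs.formPullback (hasAlgCoeffs_tra L hv) hθ
  have hdR : ∀ i, HasAlgCoeffs (formD (rPolyT L v) i) := hR.formD
  have hιθR : ∀ i, HasAlgCoeffs ((formPullback iota (theta1 L) + formD (rPolyT L v)) i) :=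
    fun i => (hιθ i).add (hdR i)
  have hν : ∀ i, HasAlgCoeffs (nuT1 L v i) := fun i => ((htθ i).sub (hιθ i)).sub (hdR i)
  set Γ := liftPathT L hv g hg hΛ hne h0 h1 with hΓ
  have rι := IsElementaryRelation.pushforward (curveT L v) (curve L) hET hE iota hasAlgCoeffs_iota
    (iota_mapsTo_T L v) (theta1 L) hθ (formPullback iota (theta1 L)) hιθ rfl
    Γ (liftPath L g hg hΛ h0 h1) (fun t _ => by
      rw [iota_eval, liftPath_toFun, hΓ, liftPathT_toFun]
      rfl)
  have rt := IsElementaryRelation.pushforward (curveT L v) (curve L) hET hE (tra L v)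
    (hasAlgCoeffs_tra L hv) (tra_mapsTo L v hv.1) (theta1 L) hθ (formPullback (tra L v) (theta1 L))
    htθ rfl Γ (liftPath L (fun t => g t + v) hg' hΛ' h0' h1') (fun t ht => by
      rw [liftPath_toFun, hΓ, liftPathT_toFun, tra_psiT L v (hΛ t ht) hv.1 (hne t ht)])
  have radd1 := IsElementaryRelation.add (curveT L v) hET Γ
    (formPullback (tra L v) (theta1 L)) (formPullback iota (theta1 L) + formD (rPolyT L v))
    (nuT1 L v) htθ hιθR hν (by rw [nuT1]; abel)
  have radd2 := IsElementaryRelation.add (curveT L v) hET Γ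
    (formPullback iota (theta1 L) + formD (rPolyT L v)) (formPullback iota (theta1 L))
    (formD (rPolyT L v)) hιθR hιθ hdR rfl
  have rvan := IsElementaryRelation.vanish (curveT L v) hET Γ (nuT1 L v) hν
    (vanishesOn_nuT1 L v hET hv.1)
  have rex := IsElementaryRelation.exact (curveT L v) hET Γ (rPolyT L v) hR
    (formD (rPolyT L v)) hdR rfl
  have e1 : Γ.toFun 1 = psiT L v (g 1) := by rw [hΓ]; rfl
  have e0 : Γ.toFun 0 = psiT L v (g 0) := by rw [hΓ]; rfl
  rw [e1, e0] at rex
  obtain ⟨k, ρ, cf, hρ, hcf, hsum⟩ :=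
    span_add (span_add (span_add (span_add (span_sub (span_of_rel rι) (span_of_rel rt))
      (span_of_rel radd1)) (span_of_rel radd2)) (span_of_rel rvan)) (span_of_rel rex)
  refine ⟨k, ρ, cf, hρ, hcf, ?_⟩
  rw [← hsum]
  abel

end Translate

/-- The constant of `span_translate_theta1` is algebraic. [folklore] -/
theorem isAlgebraic_translate_const (hv : IsAlgPt L v) {a b : ℂ} (ha : IsAlgPt L a)
    (hb : IsAlgPt L b) :
    IsAlgebraic ℚ (eval (psiT L v b) (rPolyT L v) - eval (psiT L v a) (rPolyT L v)) :=
  (isAlgebraic_eval_rPolyT L hb hv).sub (isAlgebraic_eval_rPolyT L ha hv)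

end Ell

end CurvePeriods

end Literature.NumberTheory.Transcendental

end
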